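import Literature.RingTheory.MvPolynomial.CubicFormLinearSubspaces
import HarnessLib

/-!
# Two zeros of a cubic form in at least six variables are joined by two lines of zeros

Let `F` be a cubic form on `kᴺ⁺¹`, `k` algebraically closed, `N ≥ 5`, and `x, y ∈ kᴺ⁺¹` zeros of
`F`. Then there is a nonzero vector `z` such that `F` vanishes identically on `span(x, z)` and on
`span(y, z)`: writing `F(s x + v) = s³ F(x) + s² A_x(v) + s B_x(v) + F(v)` with `A_x` linear and
`B_x` quadratic in `v` (the coefficients of the bihomogeneous substituted form,
`Literature.RingTheory.MvPolynomial.isBihom_aeval`), the vector `z` is a common nontrivial zero of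
the five forms `A_x, B_x, A_y, B_y, F` of positive degree in `N + 1 ≥ 6` variables
(`Literature.RingTheory.KrullDimension.exists_ne_zero_common_zero_of_isHomogeneous`, the projective
dimension theorem). Geometrically: on a cubic hypersurface `X ⊆ ℙᴺ`, `N ≥ 5`, any two points lie
on lines of `X` through a common third point (unless degenerate), the chain of lines used for
`CH₀(X) = ℤ` (cf. the greedy step `exists_finCons_eval_eq_zero` of
`Literature/RingTheory/MvPolynomial/CubicFormLinearSubspaces`, which is the case of ONE subspace).

* `eval_coeff_zero_substOne` — the `s`-constant coefficient of `F(s x + v)` is `F(v)`;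
* `exists_common_line_vector_of_cubic` — the connecting vector `z`.

Everything is proved.

## References

* folklore (chains of lines on cubic hypersurfaces; e.g. the argument behind `CH₀ = ℤ` for cubic
  hypersurfaces of dimension `≥ 2`).
-/

noncomputable section

open MvPolynomial

namespace Literature.RingTheory.MvPolynomial

universe u

variable {k : Type u} [Field k] {N : ℕ}

/-- The substituted form `F(s x + v) ∈ (k[v])[s]` for one vector `x` (the case `u = 1` of the
substitution of `exists_finCons_eval_eq_zero`). [folklore] -/
def substOne (x : Fin (N + 1) → k) (F : MvPolynomial (Fin (N + 1)) k) :
    MvPolynomial (Fin 1) (MvPolynomial (Fin (N + 1)) k) :=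
  aeval (fun m : Fin (N + 1) =>
    (∑ j : Fin 1, C (C ((![x] : Fin 1 → Fin (N + 1) → k) j m)) * X j) + C (X m) :
      Fin (N + 1) → MvPolynomial (Fin 1) (MvPolynomial (Fin (N + 1)) k)) F

/-- Unfolding `substOne` as the `u = 1` instance of the general substitution. [folklore] -/
theorem substOne_eq (x : Fin (N + 1) → k) (F : MvPolynomial (Fin (N + 1)) k) :
    substOne x F = aeval (fun m : Fin (N + 1) =>
      (∑ j : Fin 1, C (C ((![x] : Fin 1 → Fin (N + 1) → k) j m)) * X j) + C (X m) :
        Fin (N + 1) → MvPolynomial (Fin 1) (MvPolynomial (Fin (N + 1)) k)) F := rfl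

/-- `F(s x + v)` is bihomogeneous of degree `3` for a cubic form `F`. [folklore] -/
theorem isBihom_substOne {F : MvPolynomial (Fin (N + 1)) k} (hF : F.IsHomogeneous 3)
    (x : Fin (N + 1) → k) :
    ∀ α, (coeff α (substOne x F)).IsHomogeneous (3 - α.degree) ∧
      (3 < α.degree → coeff α (substOne x F) = 0) := by
  refine isBihom_aeval hF _ fun m => ?_
  refine isBihom_add (isBihom_sum _ _ fun j _ => ?_)
    (isBihom_C_of_isHomogeneous_one (isHomogeneous_X k m))
  simpa using isBihom_mul (isBihom_C_C (σ := Fin 1) (τ := Fin (N + 1))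
    ((![x] : Fin 1 → Fin (N + 1) → k) j m)) (isBihom_X (k := k) (τ := Fin (N + 1)) j)

/-- **Evaluation of `F(s x + v)` at `s := a`, `v := v` is `F(a x + v)`.** [folklore] -/
theorem eval_eval_substOne (x : Fin (N + 1) → k) (F : MvPolynomial (Fin (N + 1)) k) (a : k)
    (v : Fin (N + 1) → k) :
    eval v (eval (fun _ => C a) (substOne x F)) = eval (a • x + v) F := by
  rw [substOne_eq, eval_eval_aeval_lin]
  have h : (fun m => (∑ j : Fin 1, a * (![x] : Fin 1 → Fin (N + 1) → k) j m) + v m) = a • x + v := by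
    ext m
    simp
  rw [h]

/-- **The `s`-constant coefficient of `F(s x + v)` evaluates as `F`**: `(coeff₀ F(s x + v))(v) = F(v)`.
[folklore] -/
theorem eval_coeff_zero_substOne (x : Fin (N + 1) → k) (F : MvPolynomial (Fin (N + 1)) k)
    (v : Fin (N + 1) → k) :
    eval v (coeff 0 (substOne x F)) = eval v F := by
  classical
  have h1 := eval_eval_substOne x F 0 v
  rw [zero_smul, zero_add] at h1
  rw [← h1, eval_eval_eq_sum]
  symm
  rw [Finset.sum_eq_single (0 : Fin 1 →₀ ℕ)]
  · simp
  · intro α _ hα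
    obtain ⟨j, hj⟩ : ∃ j, α j ≠ 0 := by
      by_contra h
      push Not at h
      exact hα (Finsupp.ext fun j => by simpa using h j)
    rw [Finset.prod_eq_zero (Finset.mem_univ j) (by rw [zero_pow hj]), zero_mul]
  · intro h0
    rw [MvPolynomial.notMem_support_iff.1 h0, map_zero, mul_zero]

/-- **Vanishing on `span(x, z)` from the common zero of the coefficients**: if the coefficients
of `F(s x + v)` of `s`-degree `< 3` all vanish at `z` and `F(x) = 0`, then `F(a x + b z) = 0` for all
`a, b`. [folklore] -/
theorem eval_add_smul_eq_zero_of_coeff {F : MvPolynomial (Fin (N + 1)) k} (hF : F.IsHomogeneous 3)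
    {x z : Fin (N + 1) → k} (hx : eval x F = 0)
    (hz : ∀ α ∈ (substOne x F).support, α.degree < 3 → eval z (coeff α (substOne x F)) = 0)
    (a b : k) : eval (a • x + b • z) F = 0 := by
  have key := eval_eval_smul_eq_of_isBihom (isBihom_substOne hF x) hz (fun _ => a) b
  rw [eval_eval_substOne, eval_eval_substOne, add_zero, eval_smul_of_isHomogeneous hF, hx,
    mul_zero] at key
  exact key

/-- **Two zeros of a cubic form in `N + 1 ≥ 6` variables lie on lines of zeros through a common
vector.** For a cubic form `F` over an algebraically closed field and zeros `x, y` of `F`, there is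
`z ≠ 0` with `F(a x + b z) = F(a y + b z) = 0` for all `a, b` (a common nontrivial zero of the five
forms `A_x, B_x, A_y, B_y, F` of positive degree, fewer than the `N + 1` variables). [folklore] -/
theorem exists_common_line_vector_of_cubic [IsAlgClosed k] (hN : 5 ≤ N)
    {F : MvPolynomial (Fin (N + 1)) k} (hF : F.IsHomogeneous 3) {x y : Fin (N + 1) → k}
    (hx : eval x F = 0) (hy : eval y F = 0) :
    ∃ z : Fin (N + 1) → k, z ≠ 0 ∧ (∀ a b : k, eval (a • x + b • z) F = 0) ∧
      (∀ a b : k, eval (a • y + b • z) F = 0) := by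
  classical
  -- the conditions: coefficients of `s`-degree `1, 2` of `F(s x + v)` and `F(s y + v)`, and `F`
  set Sx : Finset (Fin 1 →₀ ℕ) := (substOne x F).support.filter (fun α => 0 < α.degree ∧ α.degree < 3)
    with hSx
  set Sy : Finset (Fin 1 →₀ ℕ) := (substOne y F).support.filter (fun α => 0 < α.degree ∧ α.degree < 3)
    with hSy
  let g : (↥Sx ⊕ ↥Sy) ⊕ Unit → MvPolynomial (Fin (N + 1)) k :=
    Sum.elim (Sum.elim (fun α => coeff α.1 (substOne x F)) (fun α => coeff α.1 (substOne y F)))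
      (fun _ => F)
  let deg : (↥Sx ⊕ ↥Sy) ⊕ Unit → ℕ :=
    Sum.elim (Sum.elim (fun α => 3 - α.1.degree) (fun α => 3 - α.1.degree)) (fun _ => 3)
  have hg : ∀ i, (g i).IsHomogeneous (deg i) := by
    rintro ((α | α) | u)
    · exact (isBihom_substOne hF x α.1).1
    · exact (isBihom_substOne hF y α.1).1
    · exact hF
  have hdeg : ∀ i, 0 < deg i := by
    rintro ((α | α) | u)
    · have := (Finset.mem_filter.1 α.2).2.2
      change 0 < 3 - α.1.degree
      omega
    · have := (Finset.mem_filter.1 α.2).2.2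
      change 0 < 3 - α.1.degree
      omega
    · exact Nat.succ_pos 2
  -- counting: `|Sx|, |Sy| ≤ 2`
  have hcount : ∀ (S : Finset (Fin 1 →₀ ℕ)), (∀ α ∈ S, 0 < α.degree ∧ α.degree < 3) → S.card ≤ 2 := by
    intro S hS
    have hinj : Set.InjOn (fun α : Fin 1 →₀ ℕ => α 0) S := by
      intro α _ β _ h
      exact Finsupp.ext fun j => by fin_cases j; exact h
    have himg : S.image (fun α : Fin 1 →₀ ℕ => α 0) ⊆ ({1, 2} : Finset ℕ) := by
      intro n hn
      obtain ⟨α, hα, rfl⟩ := Finset.mem_image.1 hn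
      have h := hS α hα
      have hdeg : α.degree = α 0 := by
        rw [Finsupp.degree_eq_sum, Fin.sum_univ_one]
      rw [hdeg] at h
      simp only [Finset.mem_insert, Finset.mem_singleton]
      omega
    calc S.card = (S.image fun α : Fin 1 →₀ ℕ => α 0).card := (Finset.card_image_of_injOn hinj).symm
      _ ≤ ({1, 2} : Finset ℕ).card := Finset.card_le_card himg
      _ = 2 := by decide
  have hcard : Fintype.card ((↥Sx ⊕ ↥Sy) ⊕ Unit) < N + 1 := by
    rw [Fintype.card_sum, Fintype.card_sum, Fintype.card_coe, Fintype.card_coe, Fintype.card_unit]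
    have h1 := hcount Sx fun α hα => (Finset.mem_filter.1 hα).2
    have h2 := hcount Sy fun α hα => (Finset.mem_filter.1 hα).2
    omega
  obtain ⟨z, hz0, hz⟩ :=
    Literature.RingTheory.KrullDimension.exists_ne_zero_common_zero_of_isHomogeneous g deg hg hdeg hcard
  have hzF : eval z F = 0 := hz (Sum.inr ())
  -- all coefficients of `s`-degree `< 3` vanish at `z`
  have hzx : ∀ α ∈ (substOne x F).support, α.degree < 3 → eval z (coeff α (substOne x F)) = 0 := by
    intro α hα hd
    by_cases h0 : α.degree = 0
    · have hα0 : α = 0 := (Finsupp.degree_eq_zero_iff α).1 h0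
      rw [hα0, eval_coeff_zero_substOne]
      exact hzF
    · exact hz (Sum.inl (Sum.inl ⟨α, Finset.mem_filter.2 ⟨hα, Nat.pos_of_ne_zero h0, hd⟩⟩))
  have hzy : ∀ α ∈ (substOne y F).support, α.degree < 3 → eval z (coeff α (substOne y F)) = 0 := by
    intro α hα hd
    by_cases h0 : α.degree = 0
    · have hα0 : α = 0 := (Finsupp.degree_eq_zero_iff α).1 h0
      rw [hα0, eval_coeff_zero_substOne]
      exact hzF
    · exact hz (Sum.inl (Sum.inr ⟨α, Finset.mem_filter.2 ⟨hα, Nat.pos_of_ne_zero h0, hd⟩⟩))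
  exact ⟨z, hz0, eval_add_smul_eq_zero_of_coeff hF hx hzx, eval_add_smul_eq_zero_of_coeff hF hy hzy⟩

end Literature.RingTheory.MvPolynomial

end
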